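import Literature.RepresentationTheory.CompactGroups.MatrixGroupExpSurjective
import Mathlib.GroupTheory.Abelianization.Defs
import Mathlib.LinearAlgebra.Dimension.Free
import HarnessLib

/-!
# A compact connected matrix group with centreless Lie algebra has dense commutator subgroup

Topic `Literature/RepresentationTheory/CompactGroups`.  Continuation of
`MatrixGroupExpSurjective.lean` (closed unitary matrix groups `S ⊆ M_n(ℂ)`, their Lie algebra
`L(S)`, the closed-subgroup theorem and the surjectivity of `exp` for connected `S`).  We prove
the elementary Lie-theoretic input of H. Weyl's theorem on the finiteness of the fundamental
group of a compact semisimple Lie group (T. Bröcker, T. tom Dieck, *Representations of Compact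
Lie Groups* (1985), V (7.13) with (3.13): a compact connected Lie group is semisimple iff its
Lie algebra has trivial centre iff it has no non-trivial closed connected abelian normal
subgroup), in the form consumed by the covering-space criterion
`Literature.Topology.CoveringSpaces.UniversalCover.finite_fundamentalGroup_of_forall_character`:

* `MatrixLie.lie_mem_lieAlg_of_commutator_mem` — for closed unitary groups `D`, `S` such that `D`
  contains all commutators `a b aᴴ bᴴ` (`a, b ∈ S`), **every bracket `[X, Y]` of elements of
  `L(S)` lies in `L(D)`** (the curves `t ↦ a e^{tY} aᴴ e^{-tY}`, `a = e^{sX}`, lie in `D` and have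
  tangent `Ad(a) Y - Y` at `0`; then `s ↦ Ad(e^{sX}) Y - Y` is a curve in `L(D)` with tangent
  `[X, Y]`).
* `MatrixLie.lieAlg_eq_of_center_eq_zero` — if moreover `D ⊆ S` and `L(S)` has trivial centre
  then **`L(D) = L(S)`**: a vector of `L(S)` orthogonal to all brackets for the `ad`-invariant
  trace form `Re tr (Z W)` (negative definite on skew-Hermitian matrices) is central
  (Bröcker–tom Dieck V (5.11) / I (3.14): `𝔤 = 𝔷(𝔤) ⊕ [𝔤, 𝔤]` for the Lie algebra of a compact
  group).
* **`MatrixLie.subset_of_commutator_mem`**, `MatrixLie.subset_closure_commutator` — hence for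
  CONNECTED `S` with centreless `L(S)`, `S = exp L(S) = exp L(D) ⊆ D`; with `D` the closure of
  the submonoid generated by the commutators: **the commutator subgroup of `S` is dense**.
* `MatrixLie.center_lieAlg_eq_zero_of_faithful`,
  **`MatrixLie.topologicalClosure_commutator_eq_top_of_faithful`**,
  `MatrixLie.monoidHom_eq_one_of_faithful` — the abstract statements for a compact connected
  topological group `G` with a faithful continuous finite-dimensional representation in which
  every closed connected abelian normal subgroup is trivial (the hypothesis of the named fact
  `CompactSemisimpleUniversalCover`): the Lie algebra of its unitarised image has trivial centre
  (a central `Z` generates a one-parameter central subgroup whose closure is a closed connected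
  abelian normal subgroup), the commutator subgroup of `G` is dense, and **every continuous
  homomorphism from `G` to a `T₁` commutative topological group is trivial** — in particular
  `G` has no non-trivial continuous characters `G →* Circle`.

Everything here is proved; there are no definitions and no named facts.

## References

* T. Bröcker, T. tom Dieck, *Representations of Compact Lie Groups*, GTM 98, Springer 1985,
  I (3.11), IV (2.2), V (3.13), (5.11), (7.13). [BrockerTomDieck1985]
-/

noncomputable section

open scoped Matrix.Norms.Operator ComplexOrder
open NormedSpace Matrix Topology Filter Set

namespace Literature.RepresentationTheory.CompactGroups

namespace MatrixLie

variable {ι : Type*} [Fintype ι] [DecidableEq ι]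

/-! ### Brackets lie in the Lie algebra of any closed group containing the commutators -/

section Commutator

variable {S D : Set (Matrix ι ι ℂ)}

/-- In a closed unitary group, `(exp (t X))ᴴ = exp (t (-X))` for `X ∈ L(S)`. [folklore] -/
theorem conjTranspose_exp_smul (hS : IsClosedUnitaryGroup S) {X : Matrix ι ι ℂ}
    (hX : X ∈ lieAlg hS) (t : ℝ) : (exp (t • X))ᴴ = exp (t • (-X)) := by
  rw [← hS.inv_eq_star (hX t), ← Matrix.exp_neg, smul_neg]

/-- **Brackets of `L(S)` lie in `L(D)`** whenever the closed unitary group `D` contains all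
commutators `a b aᴴ bᴴ` of elements of the closed unitary group `S`: for `a = exp (s X)` the
curve `t ↦ a e^{tY} aᴴ e^{-tY}` lies in `D`, starts at `1` and has tangent `a Y aᴴ - Y`, so
`Ad(e^{sX}) Y - Y ∈ L(D)` for every `s`, and this curve in the (closed) subspace `L(D)` has
tangent `[X, Y]` at `s = 0`. [folklore] -/
theorem lie_mem_lieAlg_of_commutator_mem (hS : IsClosedUnitaryGroup S)
    (hD : IsClosedUnitaryGroup D) (hcomm : ∀ a ∈ S, ∀ b ∈ S, a * b * aᴴ * bᴴ ∈ D)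
    {X Y : Matrix ι ι ℂ} (hX : X ∈ lieAlg hS) (hY : Y ∈ lieAlg hS) :
    X * Y - Y * X ∈ lieAlg hD := by
  -- `Ad(exp sX) Y - Y ∈ L(D)` for every `s`
  have hcurve : ∀ s : ℝ, exp (s • X) * Y * exp (s • (-X)) - Y ∈ lieAlg hD := by
    intro s
    have haS : exp (s • X) ∈ S := hX s
    have haH : (exp (s • X))ᴴ = exp (s • (-X)) := conjTranspose_exp_smul hS hX s
    have hγ : HasDerivAt
        (fun t : ℝ => exp (s • X) * exp (t • Y) * (exp (s • X))ᴴ * exp (t • (-Y)))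
        (exp (s • X) * Y * exp (s • (-X)) - Y) 0 := by
      have h1 : HasDerivAt (fun t : ℝ => exp (s • X) * exp (t • Y) * (exp (s • X))ᴴ)
          (exp (s • X) * Y * (exp (s • X))ᴴ) 0 := by
        have h := ((hasDerivAt_exp_smul_const Y (0 : ℝ)).const_mul (exp (s • X))).mul_const
          (exp (s • X))ᴴ
        simp only [zero_smul, exp_zero, one_mul] at h
        exact h
      have h2 : HasDerivAt (fun t : ℝ => exp (t • (-Y))) (-Y) 0 := by
        have h := hasDerivAt_exp_smul_const (-Y) (0 : ℝ)
        simp only [zero_smul, exp_zero, one_mul] at h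
        exact h
      have h := h1.mul h2
      simp only [zero_smul, exp_zero, mul_one] at h
      refine h.congr_deriv ?_
      rw [haH, smul_neg, exp_mul_exp_neg, Matrix.one_mul, sub_eq_add_neg]
    refine mem_lieSet_of_hasDerivAt hD (Eventually.of_forall fun t => ?_) ?_ hγ
    · have h := hcomm _ haS _ (hY t)
      rwa [conjTranspose_exp_smul hS hY t] at h
    · simp only [zero_smul, exp_zero, Matrix.mul_one]
      exact hS.mul_star_self haS
  exact mem_of_hasDerivAt_of_forall_mem (lieAlg hD) hcurve ((hasDerivAt_conj_exp X Y).sub_const Y)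

/-- `L(D) ≤ L(S)` for `D ⊆ S`. [folklore] -/
theorem lieAlg_mono (hD : IsClosedUnitaryGroup D) (hS : IsClosedUnitaryGroup S) (hDS : D ⊆ S) :
    lieAlg hD ≤ lieAlg hS := fun _ hX t => hDS (hX t)

/-- **`L(D) = L(S)` when `L(S)` has trivial centre** and the closed unitary group `D ⊆ S`
contains the commutators of `S`.  If `L(D) < L(S)`, a dimension count gives `0 ≠ Z ∈ L(S)` with
`Re tr (Z W) = 0` for all `W ∈ L(D)`, in particular for all brackets; by invariance of the trace
form, `Re tr ([X, Z] Y) = 0` for all `X, Y ∈ L(S)`, and with `Y = [X, Z]` (skew-Hermitian)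
`[X, Z] = 0`: `Z` is central, a contradiction (Bröcker–tom Dieck V (5.11):
`L(S) = 𝔷 ⊕ [L(S), L(S)]`). [cite: BrockerTomDieck1985, V (5.11)] -/
theorem lieAlg_eq_of_center_eq_zero (hS : IsClosedUnitaryGroup S) (hD : IsClosedUnitaryGroup D)
    (hDS : D ⊆ S) (hcomm : ∀ a ∈ S, ∀ b ∈ S, a * b * aᴴ * bᴴ ∈ D)
    (hz : ∀ Z ∈ lieAlg hS, (∀ X ∈ lieAlg hS, Z * X = X * Z) → Z = 0) :
    lieAlg hD = lieAlg hS := by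
  refine le_antisymm (lieAlg_mono hD hS hDS) ?_
  by_contra hnot
  -- the proper subspace `W = L(D)` of `V = L(S)`
  set V : Submodule ℝ (Matrix ι ι ℂ) := lieAlg hS with hV
  let W : Submodule ℝ V := (lieAlg hD).comap V.subtype
  have hW : W ≠ ⊤ := by
    intro hWtop
    apply hnot
    intro X hX
    have : (⟨X, hX⟩ : V) ∈ W := by rw [hWtop]; exact Submodule.mem_top
    exact this
  -- the trace form `B Z Y = Re tr (Z Y)` and `T Z = B Z|_W`
  let B : V →ₗ[ℝ] V →ₗ[ℝ] ℝ := LinearMap.mk₂ ℝ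
    (fun Z Y : V => ((Z : Matrix ι ι ℂ) * (Y : Matrix ι ι ℂ)).trace.re)
    (fun Z₁ Z₂ Y => by
      simp only [Submodule.coe_add, Matrix.add_mul, trace_add, Complex.add_re])
    (fun c Z Y => by
      simp only [Submodule.coe_smul, Matrix.smul_mul, trace_smul, Complex.real_smul,
        Complex.mul_re, Complex.ofReal_re, Complex.ofReal_im, zero_mul, sub_zero, smul_eq_mul])
    (fun Z Y₁ Y₂ => by
      simp only [Submodule.coe_add, Matrix.mul_add, trace_add, Complex.add_re])
    (fun c Z Y => by
      simp only [Submodule.coe_smul, Matrix.mul_smul, trace_smul, Complex.real_smul,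
        Complex.mul_re, Complex.ofReal_re, Complex.ofReal_im, zero_mul, sub_zero, smul_eq_mul])
  let T : V →ₗ[ℝ] (W →ₗ[ℝ] ℝ) := (LinearMap.lcomp ℝ ℝ W.subtype).comp B
  have hT : ∀ (Z : V) (Y : W), T Z Y = ((Z : Matrix ι ι ℂ) * ((Y : V) : Matrix ι ι ℂ)).trace.re :=
    fun Z Y => rfl
  have hdim : Module.finrank ℝ (W →ₗ[ℝ] ℝ) < Module.finrank ℝ V := by
    haveI : Module.Free ℝ W := Module.Free.of_divisionRing ℝ W
    rw [Module.finrank_linearMap_self ℝ ℝ W]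
    exact Submodule.finrank_lt hW
  obtain ⟨Z, hZT, hZ0⟩ := Submodule.exists_mem_ne_zero_of_ne_bot
    (LinearMap.ker_ne_bot_of_finrank_lt hdim (f := T))
  -- `Z` is orthogonal to all brackets
  have horth : ∀ X ∈ lieAlg hS, ∀ Y ∈ lieAlg hS,
      ((Z : Matrix ι ι ℂ) * (X * Y - Y * X)).trace.re = 0 := by
    intro X hX Y hY
    have hmemD : X * Y - Y * X ∈ lieAlg hD := lie_mem_lieAlg_of_commutator_mem hS hD hcomm hX hY
    have hmemS : X * Y - Y * X ∈ lieAlg hS := lie_mem_lieAlg hS hX hY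
    have h := LinearMap.congr_fun (LinearMap.mem_ker.1 hZT) ⟨⟨X * Y - Y * X, hmemS⟩, hmemD⟩
    rw [hT, LinearMap.zero_apply] at h
    exact h
  -- hence `Z` is central in `L(S)`
  have hcent : ∀ X ∈ lieAlg hS, (Z : Matrix ι ι ℂ) * X = X * Z := by
    intro X hX
    have hVS : adR X (Z : Matrix ι ι ℂ) ∈ lieAlg hS := by
      rw [adR_apply]; exact lie_mem_lieAlg hS hX Z.2
    have hVH : (adR X (Z : Matrix ι ι ℂ))ᴴ = -adR X Z := conjTranspose_eq_neg hS hVS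
    have h1 : ((adR X (Z : Matrix ι ι ℂ)) * adR X Z).trace.re = 0 := by
      have h := horth X hX (adR X Z) hVS
      rw [← adR_apply] at h
      have h' := trace_adR_mul X (Z : Matrix ι ι ℂ) (adR X Z)
      rw [h', Complex.neg_re, neg_eq_zero]
      exact h
    have h2 : (((adR X (Z : Matrix ι ι ℂ))ᴴ * adR X Z).trace).re = 0 := by
      rw [hVH, neg_mul, trace_neg, Complex.neg_re, h1, neg_zero]
    have h3 := eq_zero_of_re_trace_conjTranspose_mul_self h2
    rw [adR_apply, sub_eq_zero] at h3
    exact h3.symm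
  exact hZ0 (Subtype.ext (hz Z Z.2 hcent))

/-- **A connected closed unitary group with centreless Lie algebra is contained in any closed
unitary group `D ⊆ S` containing its commutators**: `S = exp L(S) = exp L(D) ⊆ D`
(surjectivity of `exp`, Bröcker–tom Dieck IV (2.2), and `lieAlg_eq_of_center_eq_zero`).
[cite: BrockerTomDieck1985, IV (2.2)] -/
theorem subset_of_commutator_mem (hS : IsClosedUnitaryGroup S) (hconn : IsPreconnected S)
    (hD : IsClosedUnitaryGroup D) (hDS : D ⊆ S) (hcomm : ∀ a ∈ S, ∀ b ∈ S, a * b * aᴴ * bᴴ ∈ D)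
    (hz : ∀ Z ∈ lieAlg hS, (∀ X ∈ lieAlg hS, Z * X = X * Z) → Z = 0) : S ⊆ D := by
  intro g hg
  obtain ⟨X, hX, rfl⟩ := exists_exp_eq hS hconn hg
  have hXD : X ∈ lieAlg hD := by
    rw [lieAlg_eq_of_center_eq_zero hS hD hDS hcomm hz]
    exact hX
  exact exp_mem_of_mem_lieSet hXD

/-- **The closed commutator group.**  For a closed unitary group `S`, the closure `D` of the
submonoid generated by the commutators `a b aᴴ bᴴ` (`a, b ∈ S`) is a closed unitary group
contained in `S` and containing these commutators. [folklore] -/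
theorem isClosedUnitaryGroup_closure_commutator (hS : IsClosedUnitaryGroup S) :
    IsClosedUnitaryGroup (closure ((Submonoid.closure
        {M : Matrix ι ι ℂ | ∃ a ∈ S, ∃ b ∈ S, M = a * b * aᴴ * bᴴ} :
          Submonoid (Matrix ι ι ℂ)) : Set (Matrix ι ι ℂ))) ∧
      closure ((Submonoid.closure
        {M : Matrix ι ι ℂ | ∃ a ∈ S, ∃ b ∈ S, M = a * b * aᴴ * bᴴ} :
          Submonoid (Matrix ι ι ℂ)) : Set (Matrix ι ι ℂ)) ⊆ S ∧
      ∀ a ∈ S, ∀ b ∈ S, a * b * aᴴ * bᴴ ∈ closure ((Submonoid.closure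
        {M : Matrix ι ι ℂ | ∃ a ∈ S, ∃ b ∈ S, M = a * b * aᴴ * bᴴ} :
          Submonoid (Matrix ι ι ℂ)) : Set (Matrix ι ι ℂ)) := by
  set C : Set (Matrix ι ι ℂ) := {M | ∃ a ∈ S, ∃ b ∈ S, M = a * b * aᴴ * bᴴ} with hC
  set M₀ : Submonoid (Matrix ι ι ℂ) := Submonoid.closure C with hM₀
  -- `M₀ ⊆ S`
  let S' : Submonoid (Matrix ι ι ℂ) :=
    { carrier := S
      mul_mem' := fun ha hb => hS.mul_mem ha hb
      one_mem' := hS.one_mem }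
  have hCS : C ⊆ S := by
    rintro _ ⟨a, ha, b, hb, rfl⟩
    exact hS.mul_mem (hS.mul_mem (hS.mul_mem ha hb) (hS.star_mem ha)) (hS.star_mem hb)
  have hM₀S : (M₀ : Set (Matrix ι ι ℂ)) ⊆ S := by
    have : M₀ ≤ S' := Submonoid.closure_le.2 hCS
    exact fun x hx => this hx
  -- `M₀` is closed under `ᴴ`
  have hCstar : ∀ c ∈ C, cᴴ ∈ C := by
    rintro _ ⟨a, ha, b, hb, rfl⟩
    refine ⟨b, hb, a, ha, ?_⟩
    simp only [conjTranspose_mul, conjTranspose_conjTranspose, Matrix.mul_assoc]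
  have hstar : ∀ x ∈ (M₀ : Set (Matrix ι ι ℂ)), xᴴ ∈ (M₀ : Set (Matrix ι ι ℂ)) := by
    intro x hx
    induction hx using Submonoid.closure_induction with
    | mem x hx => exact Submonoid.subset_closure (hCstar x hx)
    | one => rw [conjTranspose_one]; exact M₀.one_mem
    | mul x y _ _ hx hy => rw [conjTranspose_mul]; exact M₀.mul_mem hy hx
  have hD : IsClosedUnitaryGroup (closure (M₀ : Set (Matrix ι ι ℂ))) :=
    IsClosedUnitaryGroup.closure M₀.one_mem (fun a b ha hb => M₀.mul_mem ha hb)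
      (fun a ha => hstar a ha) (fun a ha => hS.mem_unitary (hM₀S ha))
  refine ⟨hD, closure_minimal hM₀S hS.isClosed, fun a ha b hb => ?_⟩
  exact subset_closure (Submonoid.subset_closure ⟨a, ha, b, hb, rfl⟩)

/-- **The commutator subgroup of a connected closed unitary group with centreless Lie algebra
is dense**: `S` is contained in the closure of the submonoid generated by its commutators
`a b aᴴ bᴴ` (the Lie-theoretic half of Bröcker–tom Dieck V (7.13): a semisimple compact
connected group has no non-trivial continuous characters). [cite: BrockerTomDieck1985, V (7.13)] -/
theorem subset_closure_commutator (hS : IsClosedUnitaryGroup S) (hconn : IsPreconnected S)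
    (hz : ∀ Z ∈ lieAlg hS, (∀ X ∈ lieAlg hS, Z * X = X * Z) → Z = 0) :
    S ⊆ closure ((Submonoid.closure
        {M : Matrix ι ι ℂ | ∃ a ∈ S, ∃ b ∈ S, M = a * b * aᴴ * bᴴ} :
          Submonoid (Matrix ι ι ℂ)) : Set (Matrix ι ι ℂ)) := by
  obtain ⟨hD, hDS, hcomm⟩ := isClosedUnitaryGroup_closure_commutator hS
  exact subset_of_commutator_mem hS hconn hD hDS hcomm hz

end Commutator

/-! ### The abstract statements -/

section Abstract

open Literature.RepresentationTheory.CompactGroups.CompactGroup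

variable {G : Type*} [Group G] [TopologicalSpace G] [IsTopologicalGroup G] [CompactSpace G]
  [ConnectedSpace G]

omit [CompactSpace G] [ConnectedSpace G] in
/-- The closure of a commutative subset of a Hausdorff topological group is commutative.
[folklore] -/
theorem commute_of_mem_closure_of_group [T2Space G] {A : Set G} (hA : ∀ a ∈ A, ∀ b ∈ A, a * b = b * a)
    {a b : G} (ha : a ∈ closure A) (hb : b ∈ closure A) : a * b = b * a := by
  have hcl : IsClosed {p : G × G | p.1 * p.2 = p.2 * p.1} :=
    isClosed_eq (by fun_prop) (by fun_prop)
  have hsub : A ×ˢ A ⊆ {p : G × G | p.1 * p.2 = p.2 * p.1} := fun p hp => hA _ hp.1 _ hp.2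
  have : (a, b) ∈ closure (A ×ˢ A) := by rw [closure_prod_eq]; exact ⟨ha, hb⟩
  exact closure_minimal hsub hcl this

/-- **The Lie algebra of a faithfully represented compact connected group without non-trivial
closed connected abelian normal subgroups has trivial centre** (Bröcker–tom Dieck V (3.13) /
(7.13) (i): semisimple ⟺ `Z(G)₀ = 1`).  If `Z ∈ L(S)` is central (`S` the image of the injective
continuous unitary `σ`), `t ↦ σ⁻¹ (exp (t Z))` is a continuous one-parameter subgroup of `G`,
central (`central_of_forall_commute_exp`); the closure of its image is a closed connected abelian
normal subgroup, hence trivial, so `exp (t Z) = 1` for all `t` and `Z = 0`.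
[cite: BrockerTomDieck1985, V (3.13)] -/
theorem center_lieAlg_eq_zero_of_faithful {N : Type*} [Fintype N] [DecidableEq N]
    (σ : G →* Matrix N N ℂ) (hσc : Continuous σ) (hσinj : Function.Injective σ)
    (hS : IsClosedUnitaryGroup (Set.range σ))
    (hss : ∀ A : Subgroup G, A.Normal → IsClosed (A : Set G) → IsPreconnected (A : Set G) →
      (∀ a ∈ A, ∀ b ∈ A, a * b = b * a) → A = ⊥)
    {Z : Matrix N N ℂ} (hZ : Z ∈ lieAlg hS) (hZc : ∀ X ∈ lieAlg hS, Z * X = X * Z) : Z = 0 := by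
  classical
  have hconn : IsPreconnected (Set.range σ) := isPreconnected_range hσc
  have hemb : IsClosedEmbedding σ := hσc.isClosedEmbedding hσinj
  haveI : T2Space G := hemb.isEmbedding.t2Space
  haveI : Nonempty G := ⟨1⟩
  -- `exp (t Z)` is central in `S`
  have hcentral : ∀ (t : ℝ), ∀ g ∈ Set.range σ, g * exp (t • Z) = exp (t • Z) * g := by
    intro t
    refine central_of_forall_commute_exp hS hconn fun X hX => ?_
    have hc : Commute (t • Z) X := (show Commute Z X from hZc X hX).smul_left t
    exact (hc.exp_left.exp_right).eq
  -- the one-parameter subgroup `g` of `G` with `σ (g t) = exp (t Z)`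
  let g : ℝ → G := fun t => Function.invFun σ (exp (t • Z))
  have hg : ∀ t, σ (g t) = exp (t • Z) := fun t => Function.invFun_eq (hZ t)
  have hgc : Continuous g := by
    rw [hemb.isInducing.continuous_iff]
    have : σ ∘ g = fun t => exp (t • Z) := funext fun t => hg t
    rw [this]
    exact exp_continuous.comp (continuous_id.smul continuous_const)
  have hg0 : g 0 = 1 := hσinj (by rw [hg, zero_smul, exp_zero, map_one])
  have hgadd : ∀ s t, g (s + t) = g s * g t := fun s t => hσinj (by
    rw [map_mul, hg, hg, hg, add_smul]
    exact exp_add_of_commute ((Commute.refl Z).smul_left s |>.smul_right t))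
  have hginv : ∀ t, (g t)⁻¹ = g (-t) := fun t => by
    rw [inv_eq_iff_mul_eq_one, ← hgadd, add_neg_cancel, hg0]
  have hgcent : ∀ t x, g t * x = x * g t := fun t x => hσinj (by
    rw [map_mul, map_mul, hg]
    exact (hcentral t (σ x) ⟨x, rfl⟩).symm)
  -- the subgroup `R = g(ℝ)` and its closure `A`
  let R : Subgroup G :=
    { carrier := Set.range g
      mul_mem' := by rintro _ _ ⟨s, rfl⟩ ⟨t, rfl⟩; exact ⟨s + t, hgadd s t⟩
      one_mem' := ⟨0, hg0⟩
      inv_mem' := by rintro _ ⟨t, rfl⟩; exact ⟨-t, (hginv t).symm⟩ }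
  have hRcoe : (R : Set G) = Set.range g := rfl
  haveI : R.Normal := ⟨by
    rintro _ ⟨t, rfl⟩ x
    rw [← hgcent t x, mul_inv_cancel_right]
    exact ⟨t, rfl⟩⟩
  let A : Subgroup G := R.topologicalClosure
  have hAcoe : (A : Set G) = closure (Set.range g) := R.topologicalClosure_coe
  have hA : A = ⊥ := by
    refine hss A (Subgroup.is_normal_topologicalClosure R) R.isClosed_topologicalClosure ?_ ?_
    · rw [hAcoe]
      exact (isPreconnected_range hgc).closure
    · intro a ha b hb
      have ha' : a ∈ closure (Set.range g) := by rw [← hAcoe]; exact ha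
      have hb' : b ∈ closure (Set.range g) := by rw [← hAcoe]; exact hb
      refine commute_of_mem_closure_of_group ?_ ha' hb'
      rintro _ ⟨s, rfl⟩ _ ⟨t, rfl⟩
      rw [← hgadd, ← hgadd, add_comm]
  -- hence `exp (t Z) = 1` for all `t`, and `Z = 0`
  have hexp : ∀ t : ℝ, exp (t • Z) = 1 := by
    intro t
    have hmem : g t ∈ A := R.le_topologicalClosure ⟨t, rfl⟩
    rw [hA, Subgroup.mem_bot] at hmem
    rw [← hg, hmem, map_one]
  have h1 : HasDerivAt (fun t : ℝ => exp (t • Z)) Z 0 := by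
    have h := hasDerivAt_exp_smul_const Z (0 : ℝ)
    simp only [zero_smul, exp_zero, one_mul] at h
    exact h
  have h2 : HasDerivAt (fun t : ℝ => exp (t • Z)) 0 0 := by
    have : (fun t : ℝ => exp (t • Z)) = fun _ => 1 := funext hexp
    rw [this]
    exact hasDerivAt_const 0 1
  exact h1.unique h2

/-- **The commutator subgroup of a compact connected group with a faithful representation and
no non-trivial closed connected abelian normal subgroup is dense** (Bröcker–tom Dieck V (7.13):
such a group — a compact connected semisimple Lie group — has no non-trivial continuous
characters; here via `subset_closure_commutator` for the unitarised image (Weyl's unitarian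
trick, `unitarize`) and `center_lieAlg_eq_zero_of_faithful`). [cite: BrockerTomDieck1985, V (7.13)] -/
theorem topologicalClosure_commutator_eq_top_of_faithful (N : ℕ)
    (ρ : G →* Matrix (Fin N) (Fin N) ℂ) (hρ : Continuous ρ) (hinj : Function.Injective ρ)
    (hss : ∀ A : Subgroup G, A.Normal → IsClosed (A : Set G) → IsPreconnected (A : Set G) →
      (∀ a ∈ A, ∀ b ∈ A, a * b = b * a) → A = ⊥) :
    (commutator G).topologicalClosure = ⊤ := by
  classical
  set σ := unitarize ρ hρ with hσ
  have hσc : Continuous σ := continuous_unitarize ρ hρ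
  have hB := isUnit_det_unitarizer ρ hρ
  have hσinj : Function.Injective σ := by
    intro a b h
    apply hinj
    have key : ∀ g, ρ g = (unitarizer ρ hρ)⁻¹ * σ g * unitarizer ρ hρ := fun g => by
      rw [hσ, unitarize_apply, show (unitarizer ρ hρ)⁻¹ * (unitarizer ρ hρ * ρ g * (unitarizer ρ hρ)⁻¹) *
          unitarizer ρ hρ = ((unitarizer ρ hρ)⁻¹ * unitarizer ρ hρ) * ρ g *
          ((unitarizer ρ hρ)⁻¹ * unitarizer ρ hρ) by simp only [Matrix.mul_assoc],
        Matrix.nonsing_inv_mul _ hB, Matrix.one_mul, Matrix.mul_one]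
    rw [key a, key b, h]
  have hσinv : ∀ a : G, σ a⁻¹ = (σ a)ᴴ := fun a => by
    rw [hσ, unitarize_inv, Matrix.star_eq_conjTranspose]
  have hS : IsClosedUnitaryGroup (Set.range σ) :=
    { one_mem := ⟨1, map_one σ⟩
      mul_mem := by rintro _ _ ⟨a, rfl⟩ ⟨b, rfl⟩; exact ⟨a * b, map_mul σ a b⟩
      star_mem := by rintro _ ⟨a, rfl⟩; exact ⟨a⁻¹, hσinv a⟩
      mem_unitary := by rintro _ ⟨a, rfl⟩; exact unitarize_mem_unitaryGroup ρ hρ a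
      isClosed := (isCompact_range hσc).isClosed }
  have hconn : IsPreconnected (Set.range σ) := isPreconnected_range hσc
  have hemb : IsClosedEmbedding σ := hσc.isClosedEmbedding hσinj
  have hz : ∀ Z ∈ lieAlg hS, (∀ X ∈ lieAlg hS, Z * X = X * Z) → Z = 0 :=
    fun Z hZ hZc => center_lieAlg_eq_zero_of_faithful σ hσc hσinj hS hss hZ hZc
  have hsub := subset_closure_commutator hS hconn hz
  -- the commutator submonoid of `S` is the image of the commutator subgroup of `G`
  set C : Set (Matrix (Fin N) (Fin N) ℂ) :=
    {M | ∃ a ∈ Set.range σ, ∃ b ∈ Set.range σ, M = a * b * aᴴ * bᴴ} with hC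
  have hM₀ : ((Submonoid.closure C : Submonoid (Matrix (Fin N) (Fin N) ℂ)) : Set _) ⊆
      σ '' (commutator G : Set G) := by
    have hle : Submonoid.closure C ≤ (commutator G).toSubmonoid.map σ := by
      refine Submonoid.closure_le.2 ?_
      rintro _ ⟨_, ⟨x, rfl⟩, _, ⟨y, rfl⟩, rfl⟩
      refine ⟨x * y * x⁻¹ * y⁻¹, ?_, by rw [map_mul, map_mul, map_mul, hσinv, hσinv]⟩
      have h := Subgroup.commutator_mem_commutator (Subgroup.mem_top x) (Subgroup.mem_top y)
      rwa [commutatorElement_def] at h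
    intro m hm
    obtain ⟨x, hx, rfl⟩ := hle hm
    exact ⟨x, hx, rfl⟩
  -- conclusion
  rw [Subgroup.eq_top_iff']
  intro x
  have hx : σ x ∈ closure (σ '' (commutator G : Set G)) := closure_mono hM₀ (hsub ⟨x, rfl⟩)
  rw [hemb.closure_image_eq] at hx
  obtain ⟨y, hy, hxy⟩ := hx
  rw [← hσinj hxy, ← SetLike.mem_coe, Subgroup.topologicalClosure_coe]
  exact hy

/-- **A compact connected group with a faithful representation and no non-trivial closed
connected abelian normal subgroup has no non-trivial continuous homomorphism to a `T₁`
commutative topological group** — in particular no non-trivial continuous character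
`G →* Circle` (Bröcker–tom Dieck V (7.13)). [cite: BrockerTomDieck1985, V (7.13)] -/
theorem monoidHom_eq_one_of_faithful (N : ℕ)
    (ρ : G →* Matrix (Fin N) (Fin N) ℂ) (hρ : Continuous ρ) (hinj : Function.Injective ρ)
    (hss : ∀ A : Subgroup G, A.Normal → IsClosed (A : Set G) → IsPreconnected (A : Set G) →
      (∀ a ∈ A, ∀ b ∈ A, a * b = b * a) → A = ⊥)
    {A : Type*} [CommGroup A] [TopologicalSpace A] [T1Space A] (χ : G →* A)
    (hχ : Continuous χ) : χ = 1 := by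
  have hker : IsClosed (χ.ker : Set G) := by
    rw [MonoidHom.coe_ker]
    exact isClosed_singleton.preimage hχ
  have hle : (commutator G).topologicalClosure ≤ χ.ker :=
    Subgroup.topologicalClosure_minimal _ (Abelianization.commutator_subset_ker χ) hker
  rw [topologicalClosure_commutator_eq_top_of_faithful N ρ hρ hinj hss, top_le_iff] at hle
  ext x
  have hx : x ∈ χ.ker := by rw [hle]; exact Subgroup.mem_top x
  rw [MonoidHom.mem_ker] at hx
  rw [hx, MonoidHom.one_apply]

end Abstract

end MatrixLie

end Literature.RepresentationTheory.CompactGroups
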